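import Summits.CriticalPhenomena.Ising3D.Control2DL11TwoSided
import Summits.CriticalPhenomena.Ising3D.Control2DL11BoxB
import Summits.CriticalPhenomena.Ising3D.Control2DL11BoxC
import Summits.CriticalPhenomena.Ising3D.Control2DL11BoxH
import Summits.CriticalPhenomena.Ising3D.Control2DL11BoxI
import Summits.CriticalPhenomena.Ising3D.Control2DL11BoxJ
import Mathlib.Tactic.NormNum
import HarnessLib

/-!
# The full Λ = 11 class-1 window in the kernel: `0.905 < Δ_ε < 1.005` at `Δ_σ = 1/8` under `A2D′` (window `Δ_ε ≥ 0.37`)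
(cell `pub-ising3x`, seat controls-1 gen 16; KERNEL PATH for the 2D γ-certificates, Λ = 11 class-1 cover — CONTROL-ONLY)

HONEST FRAMING: lottery ticket; floor = tightest certified 3D Ising CFT bounds; no exact-solution
claim without a proof. CONTROL-ONLY (`d = 2`, `Δ_σ = 1/8`, axiom set `A2D′`); nothing about `d = 3`; weaker than the
reader-certified statement of record (`0.99 < Δ_ε < 1.00005`, no window, Λ = 19).

All ten RB-2 Λ = 11 kind-`box` certificates (A `[0, 4/25]` apart, B…J covering `[37/100, 181/200]`) kernel-complete:
* `excludedOn_2d_L11_cover037 : ExcludedOn (1/8) 2 1 (Icc (37/100) (181/200))` (B, C, the D–G cover, H, I, J chained);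
* `twoSided_2d_L11_kernel037 : TwoSided (1/8) 2 1 (37/100) (181/200) (201/200)` — the reader-certified RB-2 Λ = 11
  statement (window [0.37, 0.905]) now resting on the Lean kernel alone. No facts, standard axioms only.
-/

namespace Summit.CriticalPhenomena.Ising3D.Control2D

open Set
open Literature.MathematicalPhysics.QuantumFieldTheory.ConformalBootstrap3D

/-- **Kernel-complete cover of the `ε` locations `[37/100, 181/200]`** at `Δ_σ = 1/8` under `A2D′` (RB-2 boxes B, C,
D–G, H, I, J). CONTROL-ONLY (d = 2). [cite: RattazziEtAl2008, §5.5] -/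
theorem excludedOn_2d_L11_cover037 : ExcludedOn (1 / 8 : ℝ) 2 1 (Icc (37 / 100 : ℝ) (181 / 200)) :=
  excludedOn_Icc_append
    (excludedOn_Icc_append
      (excludedOn_Icc_append
        (excludedOn_Icc_append (excludedOn_Icc_append excludedOn_2d_L11_boxB excludedOn_2d_L11_boxC le_rfl)
          excludedOn_2d_L11_cover le_rfl)
        excludedOn_2d_L11_boxH le_rfl)
      excludedOn_2d_L11_boxI le_rfl)
    excludedOn_2d_L11_boxJ le_rfl

/-- **2D control, class 1, kernel-complete, full Λ = 11 window**: under `A2D′` at `Δ_σ = 1/8` an `ε` location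
`x ≥ 37/100` satisfies `181/200 < x < 201/200`. CONTROL-ONLY (d = 2). [cite: RattazziEtAl2008, §5.5] -/
theorem twoSided_2d_L11_kernel037 : TwoSided (1 / 8 : ℝ) 2 1 (37 / 100) (181 / 200) (201 / 200) :=
  twoSided_of_cover excludedOn_2d_L11_cover037 gapExcluded_2d_gamma_L7_e1005 (by norm_num)

end Summit.CriticalPhenomena.Ising3D.Control2D
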